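import Summits.BirchSwinnertonDyer.BirchSwinnertonDyer.Theorems.SchneiderFreeAdditiveX3PoitouTateMiddleExactDualSymmetry
import Summits.BirchSwinnertonDyer.BirchSwinnertonDyer.Theorems.SchneiderFreeAdditiveX3PoitouTateMuMiddleExactReal
import HarnessLib

/-!
# Poitou–Tate toolkit: transport of Milne I Thm. 4.10(b) along isomorphisms of modules, and the
# instances `M = μₚ^D` and `M = ℤ/p` (constant coefficients) — UNCONDITIONAL

Cell `bsd-schneider-ideate`, seat `bsd-schneider-door-c6` (prover, generation 7).  PARTITION: board row
B6 ∩ X3 ∩ sst-twist, `r = 1` — CONTROL corner (crux `AnticycControlAdditiveK`, stmt-BirchSwinnertonDyer-19295;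
stubs `stub_baseCountTors` / `stub_ptSurj` hinge on `hE` for ALL finite `M`).  THEOREMS ONLY.  HONEST
FRAMING: two more instances of `hE` (after door-c6 g6's `μₚ`), not the general statement; no case of BSD.

* §1 `exists_inverse_intertwining_of_bijective` (the inverse of a bijective intertwining map of discrete
  modules is intertwining), `exists_tateDual_precomp_intertwining` (`φ^D : M₂^D → M₁^D`, `f ↦ f ∘ φ`),
  `localTatePairing_map_eq` (`⟨κ_* t, y⟩_{M₁} = ⟨t, κ^D_* y⟩_{M₂}`, adjoint naturality of the cup product,
  `ContPairing.cupProduct_adjoint`).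
* §2 **`middleExact_of_equiv`** — `hE(M₁, S) → hE(M₂, S)` along a pair `ι : M₁ → M₂`, `κ : M₂ → M₁` of
  intertwining maps with `ι ∘ κ = id`; canonical form `middleExact_canonical_of_equiv`.
* §3 **`middleExact_canonical_muDual`** — Milne I Thm. 4.10(b) `Ker γ¹ ⊆ Im β¹` for `M = μₚ^D = Hom(μₚ, μₚ)`,
  THE invariant maps, every admissible `S`, over any number field for odd `p` and over totally complex ones
  for `p = 2`: door-c6 g6's `middleExact_mu_of_isComplex_or_odd` transported to `μₚ^{DD}` (§2, biduality)
  is `hE(μₚ^{DD}) = hE((μₚ^D)^D)`, whence `hE(μₚ^D)` by the duality symmetry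
  `middleExact_canonical_of_middleExact_tateDual` (file `…DualSymmetry`).
* §4 **`middleExact_canonical_trivial`** — the same for the CONSTANT module `ℤ/p`
  (`ContinuousRep.trivial Γ_K ℤ (ZMod p)`), via the isomorphism `ℤ/p ⥲ Hom(μₚ, μₚ)`, `m ↦ m·id` (§1, §2).
References: [MilneADT2006] I Prop. 0.19, Cor. 2.3, Thm. 4.10 (b); [NeukirchSchmidtWingberg2008] I §4 (1.4.2),
VIII §6; [CasselsFrohlichANT1967] VII §11.
-/

noncomputable section

open Function NumberField IsDedekindDomain CategoryTheory
open scoped NumberField ContRepresentation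

universe u

set_option linter.dupNamespace false
set_option autoImplicit false

namespace Summit.BirchSwinnertonDyer.BirchSwinnertonDyer.Theorems.SchneiderFreeAdditiveX3.PoitouTateReduction

open Field
open Literature.NumberTheory.GaloisRepresentations Literature.NumberTheory.GaloisCohomology
open _root_.TopRep _root_.ContRepresentation _root_.ContinuousCohomology
open Literature.NumberTheory.GaloisRepresentations.DiscreteGaloisModule (mu MuCarrier TateDual tateDual
  tateDualEval tateDualPairingLocal localTatePairing localTatePairingZMod unramifiedSubgroup homOfIntertwining)
open Summit.BirchSwinnertonDyer.Rank1Residual.X11b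

/-! ## §1. Intertwining maps: inverses, Tate duals, and the local Tate pairing -/

section Maps

variable {K : Type u} [Field K]
variable {M₁ : Type u} [AddCommGroup M₁] [TopologicalSpace M₁] [DiscreteTopology M₁]
variable {M₂ : Type u} [AddCommGroup M₂] [TopologicalSpace M₂] [DiscreteTopology M₂]
variable {ρ₁ : DiscreteGaloisModule K M₁} {ρ₂ : DiscreteGaloisModule K M₂}

/-- **The inverse of a bijective intertwining map of discrete Galois modules is an intertwining map.**
[cite: MilneADT2006, Ch. I §0] -/
theorem exists_inverse_intertwining_of_bijective (φ : ρ₁.toContRepresentation →ⁱL ρ₂.toContRepresentation)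
    (hφ : Bijective φ) :
    ∃ ψ : ρ₂.toContRepresentation →ⁱL ρ₁.toContRepresentation,
      (∀ m : M₁, ψ (φ m) = m) ∧ ∀ m' : M₂, φ (ψ m') = m' := by
  let e : M₁ ≃+ M₂ := AddEquiv.ofBijective φ hφ
  have he : ∀ m : M₁, e m = φ m := fun m => rfl
  refine ⟨{ toContinuousLinearMap := ⟨e.symm.toAddMonoidHom.toIntLinearMap, continuous_of_discreteTopology⟩
            isIntertwining' := fun σ => ContinuousLinearMap.ext fun m' => ?_ },
    fun m => e.symm_apply_apply m, fun m' => ?_⟩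
  · change e.symm (ρ₂.toContRepresentation σ m') = ρ₁.toContRepresentation σ (e.symm m')
    apply e.injective
    rw [AddEquiv.apply_symm_apply, he, ContIntertwiningMap.isIntertwining φ σ, ← he,
      AddEquiv.apply_symm_apply]
  · change φ (e.symm m') = m'
    rw [← he, AddEquiv.apply_symm_apply]

variable [Finite M₁] [Finite M₂]

/-- **Functoriality of the Tate dual**: an intertwining map `φ : M₁ → M₂` induces the intertwining map
`φ^D : M₂^D → M₁^D`, `f ↦ f ∘ φ` (`(σ(f ∘ φ))(m) = σ f(φ(σ⁻¹ m)) = (σ f)(φ m)`).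
[cite: MilneADT2006, Ch. I §0 (M^D = Hom(M, μ))] -/
theorem exists_tateDual_precomp_intertwining (n : ℕ)
    (φ : ρ₁.toContRepresentation →ⁱL ρ₂.toContRepresentation) :
    ∃ φD : (ρ₂.tateDual n).toContRepresentation →ⁱL (ρ₁.tateDual n).toContRepresentation,
      ∀ (f : TateDual K M₂ n) (m : M₁), φD f m = f (φ m) := by
  let D : TateDual K M₂ n →+ TateDual K M₁ n :=
    { toFun := fun f => ((f : M₂ →+ MuCarrier K n).comp
        (φ.toContinuousLinearMap.toLinearMap.toAddMonoidHom) : M₁ →+ MuCarrier K n)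
      map_zero' := DiscreteGaloisModule.TateDual.ext fun m => rfl
      map_add' := fun f g => DiscreteGaloisModule.TateDual.ext fun m => rfl }
  have hD : ∀ (f : TateDual K M₂ n) (m : M₁), D f m = f (φ m) := fun f m => rfl
  refine ⟨{ toContinuousLinearMap := ⟨D.toIntLinearMap, continuous_of_discreteTopology⟩
            isIntertwining' := fun σ => ContinuousLinearMap.ext fun f =>
              DiscreteGaloisModule.TateDual.ext fun m => ?_ }, fun f m => rfl⟩
  change D (ρ₂.tateDual n σ f) m = ρ₁.tateDual n σ (D f) m
  rw [hD, DiscreteGaloisModule.tateDual_apply_apply_apply, DiscreteGaloisModule.tateDual_apply_apply_apply, hD]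
  congr 2
  exact (ContIntertwiningMap.isIntertwining φ σ⁻¹ m).symm

end Maps

section Pairing

variable {K : Type u} [Field K] [NumberField K] {n : ℕ}
variable {M₁ : Type u} [AddCommGroup M₁] [TopologicalSpace M₁] [DiscreteTopology M₁] [Finite M₁]
variable {M₂ : Type u} [AddCommGroup M₂] [TopologicalSpace M₂] [DiscreteTopology M₂] [Finite M₂]
variable {ρ₁ : DiscreteGaloisModule K M₁} {ρ₂ : DiscreteGaloisModule K M₂}

/-- **`⟨κ_* t, y⟩_{M₁,v} = ⟨t, κ^D_* y⟩_{M₂,v}` in `H²(K_v, μₙ)`** for an intertwining map `κ : M₂ → M₁`,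
local classes `t ∈ H¹(K_v, M₂)`, `y ∈ H¹(K_v, M₁^D)`: adjoint naturality of the cup product
(`ContPairing.cupProduct_adjoint`; `(κ^D f)(m) = f(κ m)`). [cite: NeukirchSchmidtWingberg2008, I §4 (1.4.2)]
[cite: MilneADT2006, Ch. I, Cor. 2.3] -/
theorem localTatePairing_map_eq (κ : ρ₂.toContRepresentation →ⁱL ρ₁.toContRepresentation)
    (κD : (ρ₁.tateDual n).toContRepresentation →ⁱL (ρ₂.tateDual n).toContRepresentation)
    (hκD : ∀ (f : TateDual K M₁ n) (m : M₂), κD f m = f (κ m)) (v : Place K)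
    (t : galoisCohomology (ρ₂.toLocal v) 1) (y : galoisCohomology ((ρ₁.tateDual n).toLocal v) 1) :
    localTatePairing ρ₁ n v (galoisCohomology.map (κ.restrictField (Place.Completion v)) 1 t) y =
      localTatePairing ρ₂ n v t (galoisCohomology.map (κD.restrictField (Place.Completion v)) 1 y) := by
  haveI : CompactSpace (absoluteGaloisGroup (Place.Completion (K := K) v)) := absoluteGaloisGroup_compactSpace _
  set E := Place.Completion (K := K) v with hE
  set κE := homOfIntertwining (κ.restrictField E) with hκE
  set κDE := homOfIntertwining (κD.restrictField E) with hκDE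
  have hc : ∀ (x : M₂) (f : TateDual K M₁ n),
      (tateDualPairingLocal ρ₁ n v).toLin (κE.hom x) f = (tateDualPairingLocal ρ₂ n v).toLin x (κDE.hom f) := by
    intro x f
    change f (κ x) = κD f x
    rw [hκD]
  exact ContPairing.cupProduct_adjoint (tateDualPairingLocal ρ₂ n v) (tateDualPairingLocal ρ₁ n v) κE κDE hc t y

/-- `ℤ/n`-valued form of `localTatePairing_map_eq` (through any additive `inv_v`).
[cite: MilneADT2006, Ch. I, Cor. 2.3] -/
theorem localTatePairingZMod_map_eq (κ : ρ₂.toContRepresentation →ⁱL ρ₁.toContRepresentation)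
    (κD : (ρ₁.tateDual n).toContRepresentation →ⁱL (ρ₂.tateDual n).toContRepresentation)
    (hκD : ∀ (f : TateDual K M₁ n) (m : M₂), κD f m = f (κ m)) (v : Place K)
    (inv : galoisCohomology ((mu K n).toLocal v) 2 →+ ZMod n)
    (t : galoisCohomology (ρ₂.toLocal v) 1) (y : galoisCohomology ((ρ₁.tateDual n).toLocal v) 1) :
    localTatePairingZMod ρ₁ n v inv (galoisCohomology.map (κ.restrictField (Place.Completion v)) 1 t) y =
      localTatePairingZMod ρ₂ n v inv t (galoisCohomology.map (κD.restrictField (Place.Completion v)) 1 y) := by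
  rw [DiscreteGaloisModule.localTatePairingZMod_apply, DiscreteGaloisModule.localTatePairingZMod_apply,
    localTatePairing_map_eq κ κD hκD v t y]

end Pairing

/-! ## §2. Transport of the basic middle exactness along an isomorphism of modules -/

section Transport

variable {K : Type u} [Field K] [NumberField K] {n : ℕ}
variable {M₁ : Type u} [AddCommGroup M₁] [TopologicalSpace M₁] [DiscreteTopology M₁] [Finite M₁]
variable {M₂ : Type u} [AddCommGroup M₂] [TopologicalSpace M₂] [DiscreteTopology M₂] [Finite M₂]

/-- **Milne I Thm. 4.10(b) `Ker γ¹ ⊆ Im β¹` transports along isomorphisms of modules**: for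
intertwining maps `ι : M₁ → M₂`, `κ : M₂ → M₁` with `ι ∘ κ = id`, any family `inv` and any `S`,
`hE(M₁, S) → hE(M₂, S)`.  Given `t ∈ ⊕_{v∈S} H¹(K_v, M₂)` orthogonal to `loc(H¹_S(K, M₂^D))`: `κ_* t` is
orthogonal to `loc(H¹_S(K, M₁^D))` (`⟨κ_* t_v, y_v⟩ = ⟨t_v, (κ^D_* y)_v⟩`, `κ^D_* y` unramified outside `S`),
so `κ_* t = loc x₁` with `x₁ ∈ H¹_S(K, M₁)`, and `x = ι_* x₁` has `loc_v x = ι_* κ_* t_v = t_v`.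
[cite: MilneADT2006, Ch. I, Thm. 4.10(b)] -/
theorem middleExact_of_equiv (inv : LocalInvariants K n) (ρ₁ : DiscreteGaloisModule K M₁)
    (ρ₂ : DiscreteGaloisModule K M₂) (ι : ρ₁.toContRepresentation →ⁱL ρ₂.toContRepresentation)
    (κ : ρ₂.toContRepresentation →ⁱL ρ₁.toContRepresentation) (hικ : ∀ m : M₂, ι (κ m) = m)
    {S : Finset (Place K)}
    (hE₁ : ∀ t : Π v : Place K, galoisCohomology (ρ₁.toLocal v) 1,
      (∀ y : galoisCohomology (ρ₁.tateDual n) 1,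
        (∀ v : HeightOneSpectrum (𝓞 K), (Sum.inr v : Place K) ∉ S →
          galoisCohomology.localization (ρ₁.tateDual n) (Sum.inr v) 1 y ∈
            unramifiedSubgroup (GaloisRep.toLocal v (ρ₁.tateDual n)) 1) →
        ∑ v ∈ S, localTatePairingZMod ρ₁ n v (inv v) (t v)
          (galoisCohomology.localization (ρ₁.tateDual n) v 1 y) = 0) →
      ∃ x : galoisCohomology ρ₁ 1,
        (∀ v : HeightOneSpectrum (𝓞 K), (Sum.inr v : Place K) ∉ S →
          galoisCohomology.localization ρ₁ (Sum.inr v) 1 x ∈ unramifiedSubgroup (GaloisRep.toLocal v ρ₁) 1) ∧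
        ∀ v ∈ S, galoisCohomology.localization ρ₁ v 1 x = t v)
    (t : Π v : Place K, galoisCohomology (ρ₂.toLocal v) 1)
    (horth : ∀ y : galoisCohomology (ρ₂.tateDual n) 1,
      (∀ v : HeightOneSpectrum (𝓞 K), (Sum.inr v : Place K) ∉ S →
        galoisCohomology.localization (ρ₂.tateDual n) (Sum.inr v) 1 y ∈
          unramifiedSubgroup (GaloisRep.toLocal v (ρ₂.tateDual n)) 1) →
      ∑ v ∈ S, localTatePairingZMod ρ₂ n v (inv v) (t v)
        (galoisCohomology.localization (ρ₂.tateDual n) v 1 y) = 0) :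
    ∃ x : galoisCohomology ρ₂ 1,
      (∀ v : HeightOneSpectrum (𝓞 K), (Sum.inr v : Place K) ∉ S →
        galoisCohomology.localization ρ₂ (Sum.inr v) 1 x ∈ unramifiedSubgroup (GaloisRep.toLocal v ρ₂) 1) ∧
      ∀ v ∈ S, galoisCohomology.localization ρ₂ v 1 x = t v := by
  obtain ⟨κD, hκD⟩ := exists_tateDual_precomp_intertwining n κ
  let t₁ : Π v : Place K, galoisCohomology (ρ₁.toLocal v) 1 := fun v =>
    galoisCohomology.map (κ.restrictField (Place.Completion v)) 1 (t v)
  have horth₁ : ∀ y : galoisCohomology (ρ₁.tateDual n) 1,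
      (∀ v : HeightOneSpectrum (𝓞 K), (Sum.inr v : Place K) ∉ S →
        galoisCohomology.localization (ρ₁.tateDual n) (Sum.inr v) 1 y ∈
          unramifiedSubgroup (GaloisRep.toLocal v (ρ₁.tateDual n)) 1) →
      ∑ v ∈ S, localTatePairingZMod ρ₁ n v (inv v) (t₁ v)
        (galoisCohomology.localization (ρ₁.tateDual n) v 1 y) = 0 := by
    intro y hy
    set y₂ := galoisCohomology.map κD 1 y with hy₂
    have hlocy : ∀ v : Place K, galoisCohomology.localization (ρ₂.tateDual n) v 1 y₂ =
        galoisCohomology.map (κD.restrictField (Place.Completion v)) 1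
          (galoisCohomology.localization (ρ₁.tateDual n) v 1 y) := fun v =>
      galoisCohomology.res_map_one _ κD y
    have hy₂ur : ∀ v : HeightOneSpectrum (𝓞 K), (Sum.inr v : Place K) ∉ S →
        galoisCohomology.localization (ρ₂.tateDual n) (Sum.inr v) 1 y₂ ∈
          unramifiedSubgroup (GaloisRep.toLocal v (ρ₂.tateDual n)) 1 := fun v hv => by
      rw [hlocy]
      exact Levels.map_mem_unramifiedSubgroup _ (hy v hv)
    have h0 := horth y₂ hy₂ur
    refine Eq.trans (Finset.sum_congr rfl fun v _ => ?_) h0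
    rw [hlocy]
    exact localTatePairingZMod_map_eq κ κD hκD v (inv v) (t v) _
  obtain ⟨x₁, hx₁ur, hx₁⟩ := hE₁ t₁ horth₁
  refine ⟨galoisCohomology.map ι 1 x₁, fun v hv => ?_, fun v hv => ?_⟩
  · rw [show galoisCohomology.localization ρ₂ (Sum.inr v) 1 (galoisCohomology.map ι 1 x₁) =
        galoisCohomology.map (ι.restrictField (Place.Completion (Sum.inr v))) 1
          (galoisCohomology.localization ρ₁ (Sum.inr v) 1 x₁) from galoisCohomology.res_map_one _ ι x₁]
    exact Levels.map_mem_unramifiedSubgroup _ (hx₁ur v hv)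
  · rw [show galoisCohomology.localization ρ₂ v 1 (galoisCohomology.map ι 1 x₁) =
        galoisCohomology.map (ι.restrictField (Place.Completion v)) 1 (galoisCohomology.localization ρ₁ v 1 x₁)
      from galoisCohomology.res_map_one _ ι x₁, hx₁ v hv]
    exact Levels.map_map_eq_self_of_comp_eq (κ.restrictField (Place.Completion v))
      (ι.restrictField (Place.Completion v)) (fun m => hικ m) (t v)

end Transport

/-! ## §3. `M = μₚ^D` -/

section MuDual

variable {K : Type} [Field K] [NumberField K] {p : ℕ} [hp : Fact p.Prime]

/-- `μₚ(K̄)` is killed by `p`. [folklore] -/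
theorem mu_nsmul_eq_zero (ζ : MuCarrier K p) : p • ζ = 0 := by
  haveI : NeZero p := ⟨hp.out.ne_zero⟩
  apply (muCarrierZModEquiv K p).injective
  rw [map_nsmul, map_zero, nsmul_eq_mul, ZMod.natCast_self, zero_mul]

omit hp in
/-- **`μₚ` is unramified at every finite `v ∤ p`** (the inertia group of `K_v` fixes `μₚ(K̄)`,
`UnramifiedCup.toLocal_mu_apply_of_mem_absInertia_of_not_mem`, in `GaloisRep.IsUnramifiedAt` form).
[cite: SerreLocalFields1979, Ch. IV §4 Cor. 2 to Prop. 16] -/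
theorem isUnramifiedAt_mu (v : HeightOneSpectrum (𝓞 K)) (hv : ((p : ℕ) : 𝓞 K) ∉ v.asIdeal) :
    GaloisRep.IsUnramifiedAt v (mu K p) := by
  rw [GaloisRep.isUnramifiedAt_iff_toLocal_holds]
  intro σ hσ
  refine DFunLike.ext _ _ fun ζ => ?_
  rw [Rank1Residual.GaloisImage.UnramifiedCup.toLocal_mu_apply_of_mem_absInertia_of_not_mem p v hv hσ ζ]
  rfl

/-- **Milne *ADT* I Thm. 4.10(b) `Ker γ¹ ⊆ Im β¹` for `M = μₚ^{DD}`**, THE invariant maps, over any number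
field for odd `p` and over a totally complex one for `p = 2`: door-c6 g6's `middleExact_mu_of_isComplex_or_odd`
(`M = μₚ`) transported along biduality `μₚ ⥲ μₚ^{DD}` (`exists_bidual_intertwining`, `middleExact_of_equiv`).
[cite: MilneADT2006, Ch. I, Thm. 4.10(b) and Prop. 0.19] -/
theorem middleExact_canonical_muBidual [Finite (TateDual K (MuCarrier K p) p)]
    [Finite (TateDual K (TateDual K (MuCarrier K p) p) p)]
    (harch : (∀ w : InfinitePlace K, w.IsComplex) ∨ Odd p)
    (S : Finset (Place K)) (hinf : ∀ w : InfinitePlace K, (Sum.inl w : Place K) ∈ S)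
    (hS : ∀ v : HeightOneSpectrum (𝓞 K), (Sum.inr v : Place K) ∉ S →
      ((p : ℕ) : 𝓞 K) ∉ v.asIdeal ∧ GaloisRep.IsUnramifiedAt v (mu K p))
    (t : Π v : Place K, galoisCohomology ((((mu K p).tateDual p).tateDual p).toLocal v) 1)
    (horth : ∀ y : galoisCohomology ((((mu K p).tateDual p).tateDual p).tateDual p) 1,
      (∀ v : HeightOneSpectrum (𝓞 K), (Sum.inr v : Place K) ∉ S →
        galoisCohomology.localization ((((mu K p).tateDual p).tateDual p).tateDual p) (Sum.inr v) 1 y ∈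
          unramifiedSubgroup (GaloisRep.toLocal v ((((mu K p).tateDual p).tateDual p).tateDual p)) 1) →
      ∑ v ∈ S, localTatePairingZMod (((mu K p).tateDual p).tateDual p) p v (LocalInvariants.canonical K p v)
        (t v) (galoisCohomology.localization ((((mu K p).tateDual p).tateDual p).tateDual p) v 1 y) = 0) :
    ∃ x : galoisCohomology (((mu K p).tateDual p).tateDual p) 1,
      (∀ v : HeightOneSpectrum (𝓞 K), (Sum.inr v : Place K) ∉ S →
        galoisCohomology.localization (((mu K p).tateDual p).tateDual p) (Sum.inr v) 1 x ∈
          unramifiedSubgroup (GaloisRep.toLocal v (((mu K p).tateDual p).tateDual p)) 1) ∧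
      ∀ v ∈ S, galoisCohomology.localization (((mu K p).tateDual p).tateDual p) v 1 x = t v := by
  obtain ⟨ι, κ, -, -, hικ⟩ := exists_bidual_intertwining (n := p) (mu K p) (mu_nsmul_eq_zero (K := K) (p := p))
  exact middleExact_of_equiv (LocalInvariants.canonical K p) (mu K p) (((mu K p).tateDual p).tateDual p) ι κ
    hικ (fun t' horth' => middleExact_mu_of_isComplex_or_odd harch S hinf hS t' horth') t horth

/-- **Milne *ADT* I Thm. 4.10(b) `Ker γ¹ ⊆ Im β¹` for `M = μₚ^D = Hom(μₚ, μₚ)` (`≅ ℤ/p`), THE invariant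
maps, every admissible `S`, over any number field for odd `p` and over a totally complex one for `p = 2`**,
UNCONDITIONAL: `hE(μₚ^{DD}) = hE((μₚ^D)^D)` (`middleExact_canonical_muBidual`) and the duality symmetry
`middleExact_canonical_of_middleExact_tateDual`.  (An instance of the hypothesis `hE` of
`exists_localInvariants_duality_of_middleExact_canonical`; the general `hE` — all finite `M` — is NOT claimed.)
[cite: MilneADT2006, Ch. I, Thm. 4.10(b)] [cite: CasselsFrohlichANT1967, Ch. VII §11] -/
theorem middleExact_canonical_muDual [Finite (TateDual K (MuCarrier K p) p)]
    (harch : (∀ w : InfinitePlace K, w.IsComplex) ∨ Odd p)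
    (S : Finset (Place K)) (hinf : ∀ w : InfinitePlace K, (Sum.inl w : Place K) ∈ S)
    (hS : ∀ v : HeightOneSpectrum (𝓞 K), (Sum.inr v : Place K) ∉ S →
      ((p : ℕ) : 𝓞 K) ∉ v.asIdeal ∧ GaloisRep.IsUnramifiedAt v (mu K p))
    (t : Π v : Place K, galoisCohomology (((mu K p).tateDual p).toLocal v) 1)
    (horth : ∀ y : galoisCohomology (((mu K p).tateDual p).tateDual p) 1,
      (∀ v : HeightOneSpectrum (𝓞 K), (Sum.inr v : Place K) ∉ S →
        galoisCohomology.localization (((mu K p).tateDual p).tateDual p) (Sum.inr v) 1 y ∈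
          unramifiedSubgroup (GaloisRep.toLocal v (((mu K p).tateDual p).tateDual p)) 1) →
      ∑ v ∈ S, localTatePairingZMod ((mu K p).tateDual p) p v (LocalInvariants.canonical K p v) (t v)
        (galoisCohomology.localization (((mu K p).tateDual p).tateDual p) v 1 y) = 0) :
    ∃ x : galoisCohomology ((mu K p).tateDual p) 1,
      (∀ v : HeightOneSpectrum (𝓞 K), (Sum.inr v : Place K) ∉ S →
        galoisCohomology.localization ((mu K p).tateDual p) (Sum.inr v) 1 x ∈
          unramifiedSubgroup (GaloisRep.toLocal v ((mu K p).tateDual p)) 1) ∧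
      ∀ v ∈ S, galoisCohomology.localization ((mu K p).tateDual p) v 1 x = t v := by
  haveI : NeZero p := ⟨hp.out.ne_zero⟩
  haveI := DiscreteGaloisModule.TateDual.finite K (TateDual K (MuCarrier K p) p) p
  exact middleExact_canonical_of_middleExact_tateDual ((mu K p).tateDual p)
    (fun f => DiscreteGaloisModule.TateDual.nsmul_eq_zero f)
    (fun u hu => middleExact_canonical_muBidual harch S hinf hS u hu) t horth

end MuDual

/-! ## §4. `M = ℤ/p` (constant coefficients) -/

section Trivial

variable {K : Type} [Field K] [NumberField K] {p : ℕ} [hp : Fact p.Prime]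

/-- **`ℤ/p ⥲ Hom(μₚ, μₚ) = μₚ^D`, `m ↦ m·id`, is a bijective intertwining map** from ANY discrete Galois
module structure on `ℤ/p` with trivial action (`(σ(m·id))(ζ) = σ(m·σ⁻¹ζ) = m·ζ`; injective on a generator
of the cyclic group `μₚ(K̄) ≅ ℤ/p`, bijective as `#Hom(μₚ, μₚ) = #μₚ = p`).
[cite: MilneADT2006, Ch. I §0 (examples of M^D)] -/
theorem exists_trivial_intertwining_muDual_bijective (ρ : DiscreteGaloisModule K (ZMod p))
    (htriv : ∀ (σ : absoluteGaloisGroup K) (m : ZMod p), ρ σ m = m) :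
    ∃ φ : ρ.toContRepresentation →ⁱL ((mu K p).tateDual p).toContRepresentation,
      (∀ (m : ZMod p) (ζ : MuCarrier K p), φ m ζ = m.val • ζ) ∧ Bijective φ := by
  haveI : NeZero p := ⟨hp.out.ne_zero⟩
  -- the map on carriers
  let Φ : ZMod p →+ TateDual K (MuCarrier K p) p :=
    { toFun := fun m => ((m.val • AddMonoidHom.id (MuCarrier K p) : MuCarrier K p →+ MuCarrier K p))
      map_zero' := DiscreteGaloisModule.TateDual.ext fun ζ => by
        change (ZMod.val 0) • ζ = 0
        rw [ZMod.val_zero, zero_nsmul]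
      map_add' := fun m m' => DiscreteGaloisModule.TateDual.ext fun ζ => by
        change (m + m').val • ζ = m.val • ζ + m'.val • ζ
        rw [← add_nsmul, ZMod.val_add]
        conv_rhs => rw [← Nat.mod_add_div (m.val + m'.val) p, add_nsmul, mul_nsmul ζ p,
          mu_nsmul_eq_zero, nsmul_zero, add_zero] }
  have hΦ : ∀ (m : ZMod p) (ζ : MuCarrier K p), Φ m ζ = m.val • ζ := fun m ζ => rfl
  -- injectivity (on a generator of `μₚ(K̄) ≅ ℤ/p`)
  have hinj : Injective Φ := by
    refine (injective_iff_map_eq_zero Φ).2 fun m hm => ?_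
    let e : MuCarrier K p ≃+ ZMod p := muCarrierZModEquiv K p
    have h1 : m.val • e.symm 1 = 0 := by
      have h := hΦ m (e.symm 1)
      rw [hm, DiscreteGaloisModule.TateDual.zero_apply] at h
      exact h.symm
    have h2 : (m.val : ZMod p) = 0 := by
      have h3 := congrArg e h1
      rw [map_nsmul, AddEquiv.apply_symm_apply, map_zero, nsmul_eq_mul, mul_one] at h3
      exact h3
    rw [ZMod.natCast_zmod_val] at h2
    exact h2
  -- bijectivity by counting
  have hcard : Nat.card (TateDual K (MuCarrier K p) p) = Nat.card (ZMod p) := by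
    have hc : Nat.card (TateDual K (MuCarrier K p) p) = Nat.card (MuCarrier K p) :=
      HomCarrier.natCard_eq (muEquivZMod K p) (mu_nsmul_eq_zero (K := K) (p := p))
    rw [hc, Nat.card_congr (muCarrierZModEquiv K p).toEquiv]
  haveI : Finite (TateDual K (MuCarrier K p) p) := DiscreteGaloisModule.TateDual.finite K (MuCarrier K p) p
  have hbij : Bijective Φ := hinj.bijective_of_nat_card_le (le_of_eq hcard)
  refine ⟨{ toContinuousLinearMap := ⟨Φ.toIntLinearMap, continuous_of_discreteTopology⟩
            isIntertwining' := fun σ => ContinuousLinearMap.ext fun m =>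
              DiscreteGaloisModule.TateDual.ext fun ζ => ?_ }, fun m ζ => rfl, hbij⟩
  change Φ (ρ σ m) ζ = (mu K p).tateDual p σ (Φ m) ζ
  rw [htriv, DiscreteGaloisModule.tateDual_apply_apply_apply, hΦ, hΦ, map_nsmul,
    ← Module.End.mul_apply, ← map_mul, mul_inv_cancel, map_one, Module.End.one_apply]

/-- **Milne *ADT* I Thm. 4.10(b) `Ker γ¹ ⊆ Im β¹` for the CONSTANT module `M = ℤ/p`** (any discrete
Galois module structure `ρ` on `ZMod p` with trivial action, e.g. `ContinuousRep.trivial Γ_K ℤ (ZMod p)`),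
THE invariant maps, every finite `S ⊇ {v ∣ ∞} ∪ {v ∣ p}`, over any number field for odd `p` and over a
totally complex one for `p = 2`, UNCONDITIONAL: transport of `middleExact_canonical_muDual` along
`ℤ/p ⥲ Hom(μₚ, μₚ)`.  Classically: local characters `χ_v : Γ_{K_v} → ℤ/p` (`v ∈ S`) with
`∑_{v∈S} inv_v(χ_v ∪ y_v) = 0` for every `y ∈ H¹(K, (ℤ/p)^D)` unramified outside `S` are the restrictions of
ONE global character `Γ_K → ℤ/p` unramified outside `S`.  (An instance of the hypothesis `hE` of
`exists_localInvariants_duality_of_middleExact_canonical`; the general `hE` — all finite `M` — is NOT claimed.)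
[cite: MilneADT2006, Ch. I, Thm. 4.10(b)] [cite: NeukirchSchmidtWingberg2008, VIII §6] -/
theorem middleExact_canonical_trivial [Finite (ZMod p)] (harch : (∀ w : InfinitePlace K, w.IsComplex) ∨ Odd p)
    (ρ : DiscreteGaloisModule K (ZMod p)) (htriv : ∀ (σ : absoluteGaloisGroup K) (m : ZMod p), ρ σ m = m)
    (S : Finset (Place K)) (hinf : ∀ w : InfinitePlace K, (Sum.inl w : Place K) ∈ S)
    (hS : ∀ v : HeightOneSpectrum (𝓞 K), (Sum.inr v : Place K) ∉ S → ((p : ℕ) : 𝓞 K) ∉ v.asIdeal)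
    (t : Π v : Place K, galoisCohomology (ρ.toLocal v) 1)
    (horth : ∀ y : galoisCohomology (ρ.tateDual p) 1,
      (∀ v : HeightOneSpectrum (𝓞 K), (Sum.inr v : Place K) ∉ S →
        galoisCohomology.localization (ρ.tateDual p) (Sum.inr v) 1 y ∈
          unramifiedSubgroup (GaloisRep.toLocal v (ρ.tateDual p)) 1) →
      ∑ v ∈ S, localTatePairingZMod ρ p v (LocalInvariants.canonical K p v) (t v)
        (galoisCohomology.localization (ρ.tateDual p) v 1 y) = 0) :
    ∃ x : galoisCohomology ρ 1,
      (∀ v : HeightOneSpectrum (𝓞 K), (Sum.inr v : Place K) ∉ S →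
        galoisCohomology.localization ρ (Sum.inr v) 1 x ∈ unramifiedSubgroup (GaloisRep.toLocal v ρ) 1) ∧
      ∀ v ∈ S, galoisCohomology.localization ρ v 1 x = t v := by
  haveI : NeZero p := ⟨hp.out.ne_zero⟩
  haveI := DiscreteGaloisModule.TateDual.finite K (MuCarrier K p) p
  obtain ⟨φ, -, hφbij⟩ := exists_trivial_intertwining_muDual_bijective ρ htriv
  obtain ⟨ψ, hψφ, -⟩ := exists_inverse_intertwining_of_bijective φ hφbij
  -- `μₚ` is unramified at `v ∤ p`
  have hS' : ∀ v : HeightOneSpectrum (𝓞 K), (Sum.inr v : Place K) ∉ S →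
      ((p : ℕ) : 𝓞 K) ∉ v.asIdeal ∧ GaloisRep.IsUnramifiedAt v (mu K p) := fun v hv =>
    ⟨hS v hv, isUnramifiedAt_mu v (hS v hv)⟩
  exact middleExact_of_equiv (LocalInvariants.canonical K p) ((mu K p).tateDual p) ρ ψ φ hψφ
    (fun t' horth' => middleExact_canonical_muDual harch S hinf hS' t' horth') t horth

end Trivial

end Summit.BirchSwinnertonDyer.BirchSwinnertonDyer.Theorems.SchneiderFreeAdditiveX3.PoitouTateReduction

end
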